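import Mathlib

/-!
# The averaged equilateral-trapezoid conditions of Pratt's Question 4.9: definitions, the
second-moment identities and transport along additive maps (file 1 of 3)

K. Pratt, *On generalized corners and matrix multiplication*, arXiv:2309.03878 (v1 = the only
arXiv version; ITCS 2024, LIPIcs 287:89), §3 Definition 3.2 and §4.1 Question 4.9.

Definition 3.2 (equilateral trapezoid-free triple `A, B, C ⊆ G`): for all FIXED `a' ∈ A`,
`b' ∈ B`, `c' ∈ C` each of the three systems
(1) `0 = a' + b + c = a + b' + c`, (2) `0 = a' + b + c = a + b + c'`, (3) `0 = a + b' + c = a + b + c'`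
has at most one solution `(a, b, c) ∈ A × B × C`.  Question 4.9 replaces "at most one" by
"at most one on average over the fixed pair":

  `E_{a'∈A, b'∈B} #{(a,b,c) : 0 = a'+b+c = a+b'+c} ≤ 1`,
  `E_{a'∈A, c'∈C} #{(a,b,c) : 0 = a'+b+c = a+b+c'} ≤ 1`,
  `E_{b'∈B, c'∈C} #{(a,b,c) : 0 = a+b'+c = a+b+c'} ≤ 1`,

and asks: "What is the maximum over all `A, B, C ⊆ ℤ_n` satisfying [these] of the number of
solutions to `a + b + c = 0`?"  ([Pratt, Prop. 4.8] builds `A, B, C ⊆ ℤ_n` with `n^{3/2-o(1)}`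
solutions satisfying the FIRST averaged condition and then poses Question 4.9 for all three.)

This file (generic, any additive commutative group):
* `sol A B C` — the solutions; `sysC`, `sysB`, `sysA` — the solution sets of systems (1), (2), (3)
  for a fixed pair (named after the coordinate the two solutions share);
* `sumC = Σ_{a'∈A} Σ_{b'∈B} #sysC a' b'` etc. and `AvgTrapezoidFree A B C` := the three
  conditions multiplied out (`sumC ≤ #A·#B`, `sumB ≤ #A·#C`, `sumA ≤ #B·#C`);
  `avgTrapezoidFree_iff` — for nonempty sets this is literally "each expectation is `≤ 1`";
* the second-moment identities `sumC = Σ_{c∈C} r₁(c)·r₂(c)` (`sumC_eq`, `sumB_eq`, `sumA_eq`);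
* transport (`card_sol_image`, `avgTrapezoidFree_image`): an additive map injective on `A`, `B`,
  `C` that reflects `a + b + c = 0` on `A × B × C` preserves all four quantities (used in file 3
  to pass from `ℤ` to `ℤ_N`).

Files 2–3 (`SoloInformedValAveragedConstruction`, `SoloInformedValAveragedAnswer`) show that
Pratt's own Proposition 4.8 example satisfies ALL THREE averaged conditions, which answers
Question 4.9: the maximum is `n^{3/2-o(1)}` (it is at most `n^{3/2}` by the first condition and
Cauchy–Schwarz, [Pratt, Prop. 3.4 / §4.1]).

solo-informed MatrixMultiplication, gen 66.
-/

namespace Summit.MatrixMultiplication.MatrixMultiplication.Theorems.SoloValAvg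

open Finset

variable {G : Type*} [AddCommGroup G] [DecidableEq G]

/-- The solutions of `a + b + c = 0` in `A × B × C`. -/
def sol (A B C : Finset G) : Finset (G × G × G) :=
  (A ×ˢ B ×ˢ C).filter (fun p => p.1 + p.2.1 + p.2.2 = 0)

/-- System (1) of [Pratt, Def. 3.2] for fixed `a', b'`: the triples `(a,b,c) ∈ A × B × C` with
`0 = a' + b + c = a + b' + c` (a pair of solutions sharing the `C`-coordinate `c`). -/
def sysC (A B C : Finset G) (a' b' : G) : Finset (G × G × G) :=
  (A ×ˢ B ×ˢ C).filter (fun p => a' + p.2.1 + p.2.2 = 0 ∧ p.1 + b' + p.2.2 = 0)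

/-- System (2) for fixed `a', c'`: `0 = a' + b + c = a + b + c'` (sharing `b`). -/
def sysB (A B C : Finset G) (a' c' : G) : Finset (G × G × G) :=
  (A ×ˢ B ×ˢ C).filter (fun p => a' + p.2.1 + p.2.2 = 0 ∧ p.1 + p.2.1 + c' = 0)

/-- System (3) for fixed `b', c'`: `0 = a + b' + c = a + b + c'` (sharing `a`). -/
def sysA (A B C : Finset G) (b' c' : G) : Finset (G × G × G) :=
  (A ×ˢ B ×ˢ C).filter (fun p => p.1 + b' + p.2.2 = 0 ∧ p.1 + p.2.1 + c' = 0)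

/-- `Σ_{a'∈A} Σ_{b'∈B} #(system (1))` (= `#A·#B` times Pratt's first expectation). -/
def sumC (A B C : Finset G) : ℕ := ∑ a' ∈ A, ∑ b' ∈ B, #(sysC A B C a' b')

/-- `Σ_{a'∈A} Σ_{c'∈C} #(system (2))` (= `#A·#C` times the second expectation). -/
def sumB (A B C : Finset G) : ℕ := ∑ a' ∈ A, ∑ c' ∈ C, #(sysB A B C a' c')

/-- `Σ_{b'∈B} Σ_{c'∈C} #(system (3))` (= `#B·#C` times the third expectation). -/
def sumA (A B C : Finset G) : ℕ := ∑ b' ∈ B, ∑ c' ∈ C, #(sysA A B C b' c')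

/-- The hypothesis of [Pratt, Question 4.9]: all three expectations are at most `1`, written
multiplied out (see `avgTrapezoidFree_iff` for the expectation form). -/
def AvgTrapezoidFree (A B C : Finset G) : Prop :=
  sumC A B C ≤ #A * #B ∧ sumB A B C ≤ #A * #C ∧ sumA A B C ≤ #B * #C

/-- For nonempty `A, B, C`, `AvgTrapezoidFree A B C` says literally that each of the three
expectations `E_{a'∈A,b'∈B} #sysC`, `E_{a'∈A,c'∈C} #sysB`, `E_{b'∈B,c'∈C} #sysA` is `≤ 1`. -/
theorem avgTrapezoidFree_iff {A B C : Finset G} (hA : A.Nonempty) (hB : B.Nonempty)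
    (hC : C.Nonempty) :
    AvgTrapezoidFree A B C ↔
      (sumC A B C : ℝ) / ((#A : ℝ) * #B) ≤ 1 ∧ (sumB A B C : ℝ) / ((#A : ℝ) * #C) ≤ 1 ∧
        (sumA A B C : ℝ) / ((#B : ℝ) * #C) ≤ 1 := by
  have hA' : (0 : ℝ) < #A := by exact_mod_cast hA.card_pos
  have hB' : (0 : ℝ) < #B := by exact_mod_cast hB.card_pos
  have hC' : (0 : ℝ) < #C := by exact_mod_cast hC.card_pos
  unfold AvgTrapezoidFree
  rw [div_le_one (by positivity), div_le_one (by positivity), div_le_one (by positivity)]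
  norm_cast

/-! ## The systems are determined by the shared coordinate; second-moment identities -/

/-- `(if P ∧ Q then 1 else 0) = (if P then 1 else 0)·(if Q then 1 else 0)` in `ℕ`. -/
theorem ite_and_eq_mul (P Q : Prop) [Decidable P] [Decidable Q] :
    (if P ∧ Q then 1 else 0 : ℕ) = (if P then 1 else 0) * (if Q then 1 else 0) := by
  by_cases hP : P <;> by_cases hQ : Q <;> simp [hP, hQ]

omit [DecidableEq G] in
/-- In an additive group, `u + v + w = 0` determines `v` from `u, w`. -/
theorem eq_neg_sub_of_add_add_eq_zero {u v w : G} (h : u + v + w = 0) : v = -u - w := by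
  calc v = -u - w + (u + v + w) := by abel
    _ = -u - w := by rw [h, add_zero]

omit [DecidableEq G] in
/-- … and determines `u` from `v, w`. -/
theorem eq_neg_sub_of_add_add_eq_zero' {u v w : G} (h : u + v + w = 0) : u = -v - w := by
  calc u = -v - w + (u + v + w) := by abel
    _ = -v - w := by rw [h, add_zero]

omit [DecidableEq G] in
/-- … and determines `w` from `u, v`. -/
theorem eq_neg_sub_of_add_add_eq_zero'' {u v w : G} (h : u + v + w = 0) : w = -u - v := by
  calc w = -u - v + (u + v + w) := by abel
    _ = -u - v := by rw [h, add_zero]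

/-- A triple of system (1) is determined by its shared coordinate `c`:
`#sysC a' b' = #{c ∈ C : -a'-c ∈ B ∧ -b'-c ∈ A}`. -/
theorem card_sysC (A B C : Finset G) (a' b' : G) :
    #(sysC A B C a' b') = #(C.filter (fun c => -a' - c ∈ B ∧ -b' - c ∈ A)) := by
  rw [← card_image_of_injective (C.filter (fun c => -a' - c ∈ B ∧ -b' - c ∈ A))
    (f := fun c : G => (-b' - c, -a' - c, c))
    (by intro c₁ c₂ h; exact congrArg (fun p : G × G × G => p.2.2) h)]
  congr 1
  ext ⟨a, b, c⟩
  simp only [sysC, mem_filter, mem_product, mem_image, Prod.mk.injEq]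
  constructor
  · rintro ⟨⟨ha, hb, hc⟩, h1, h2⟩
    have hb' := eq_neg_sub_of_add_add_eq_zero h1
    have ha' := eq_neg_sub_of_add_add_eq_zero' h2
    exact ⟨c, ⟨hc, hb' ▸ hb, ha' ▸ ha⟩, ha'.symm, hb'.symm, rfl⟩
  · rintro ⟨c', ⟨hc', hb, ha⟩, rfl, rfl, rfl⟩
    exact ⟨⟨ha, hb, hc'⟩, by abel, by abel⟩

/-- `#sysB a' c' = #{b ∈ B : -a'-b ∈ C ∧ -b-c' ∈ A}` (shared coordinate `b`). -/
theorem card_sysB (A B C : Finset G) (a' c' : G) :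
    #(sysB A B C a' c') = #(B.filter (fun b => -a' - b ∈ C ∧ -b - c' ∈ A)) := by
  rw [← card_image_of_injective (B.filter (fun b => -a' - b ∈ C ∧ -b - c' ∈ A))
    (f := fun b : G => (-b - c', b, -a' - b))
    (by intro b₁ b₂ h; exact congrArg (fun p : G × G × G => p.2.1) h)]
  congr 1
  ext ⟨a, b, c⟩
  simp only [sysB, mem_filter, mem_product, mem_image, Prod.mk.injEq]
  constructor
  · rintro ⟨⟨ha, hb, hc⟩, h1, h2⟩
    have hc' := eq_neg_sub_of_add_add_eq_zero'' h1
    have ha' := eq_neg_sub_of_add_add_eq_zero' h2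
    exact ⟨b, ⟨hb, hc' ▸ hc, ha' ▸ ha⟩, ha'.symm, rfl, hc'.symm⟩
  · rintro ⟨b', ⟨hb', hc, ha⟩, rfl, rfl, rfl⟩
    exact ⟨⟨ha, hb', hc⟩, by abel, by abel⟩

/-- `#sysA b' c' = #{a ∈ A : -a-b' ∈ C ∧ -a-c' ∈ B}` (shared coordinate `a`). -/
theorem card_sysA (A B C : Finset G) (b' c' : G) :
    #(sysA A B C b' c') = #(A.filter (fun a => -a - b' ∈ C ∧ -a - c' ∈ B)) := by
  rw [← card_image_of_injective (A.filter (fun a => -a - b' ∈ C ∧ -a - c' ∈ B))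
    (f := fun a : G => (a, -a - c', -a - b'))
    (by intro a₁ a₂ h; exact congrArg (fun p : G × G × G => p.1) h)]
  congr 1
  ext ⟨a, b, c⟩
  simp only [sysA, mem_filter, mem_product, mem_image, Prod.mk.injEq]
  constructor
  · rintro ⟨⟨ha, hb, hc⟩, h1, h2⟩
    have hc' := eq_neg_sub_of_add_add_eq_zero'' h1
    have hb' := eq_neg_sub_of_add_add_eq_zero h2
    exact ⟨a, ⟨ha, hc' ▸ hc, hb' ▸ hb⟩, rfl, hb'.symm, hc'.symm⟩
  · rintro ⟨a'', ⟨ha'', hc, hb⟩, rfl, rfl, rfl⟩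
    exact ⟨⟨ha'', hb, hc⟩, by abel, by abel⟩

/-- Second-moment identity for system (1): `sumC = Σ_{c∈C} r₁(c)·r₂(c)` with
`r₁(c) = #{a' ∈ A : -a'-c ∈ B}`, `r₂(c) = #{b' ∈ B : -b'-c ∈ A}` (both equal to the number of
solutions through `c`). -/
theorem sumC_eq (A B C : Finset G) :
    sumC A B C =
      ∑ c ∈ C, #(A.filter (fun a' => -a' - c ∈ B)) * #(B.filter (fun b' => -b' - c ∈ A)) := by
  unfold sumC
  simp_rw [card_sysC, card_filter, sum_mul_sum, ite_and_eq_mul]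
  exact (sum_congr rfl fun a' _ => sum_comm).trans sum_comm

/-- Second-moment identity for system (2): `sumB = Σ_{b∈B} #{a' : -a'-b ∈ C}·#{c' : -b-c' ∈ A}`. -/
theorem sumB_eq (A B C : Finset G) :
    sumB A B C =
      ∑ b ∈ B, #(A.filter (fun a' => -a' - b ∈ C)) * #(C.filter (fun c' => -b - c' ∈ A)) := by
  unfold sumB
  simp_rw [card_sysB, card_filter, sum_mul_sum, ite_and_eq_mul]
  exact (sum_congr rfl fun a' _ => sum_comm).trans sum_comm

/-- Second-moment identity for system (3): `sumA = Σ_{a∈A} #{b' : -a-b' ∈ C}·#{c' : -a-c' ∈ B}`. -/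
theorem sumA_eq (A B C : Finset G) :
    sumA A B C =
      ∑ a ∈ A, #(B.filter (fun b' => -a - b' ∈ C)) * #(C.filter (fun c' => -a - c' ∈ B)) := by
  unfold sumA
  simp_rw [card_sysA, card_filter, sum_mul_sum, ite_and_eq_mul]
  exact (sum_congr rfl fun b' _ => sum_comm).trans sum_comm

/-! ## Transport along an additive map -/

section Transfer

variable {H : Type*} [AddCommGroup H] [DecidableEq H]

/-- The coordinatewise map on triples. -/
def tripleMap (f : G →+ H) : G × G × G → H × H × H := fun p => (f p.1, f p.2.1, f p.2.2)

omit [DecidableEq G] [DecidableEq H] in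
/-- `tripleMap f` is injective on `A × B × C` when `f` is injective on each factor. -/
theorem tripleMap_injOn (f : G →+ H) {A B C : Finset G} (hA : Set.InjOn f A)
    (hB : Set.InjOn f B) (hC : Set.InjOn f C) : Set.InjOn (tripleMap f) ↑(A ×ˢ B ×ˢ C) := by
  rintro ⟨a, b, c⟩ h ⟨a₂, b₂, c₂⟩ h₂ e
  simp only [mem_coe, mem_product] at h h₂
  simp only [tripleMap, Prod.mk.injEq] at e
  obtain ⟨e1, e2, e3⟩ := e
  simp only [Prod.mk.injEq]
  exact ⟨hA h.1 h₂.1 e1, hB h.2.1 h₂.2.1 e2, hC h.2.2 h₂.2.2 e3⟩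

variable (f : G →+ H) {A B C : Finset G}
  (hA : Set.InjOn f A) (hB : Set.InjOn f B) (hC : Set.InjOn f C)
  (hr : ∀ a ∈ A, ∀ b ∈ B, ∀ c ∈ C, f (a + b + c) = 0 → a + b + c = 0)

omit [DecidableEq G] [DecidableEq H] in
include hA hB hC in
/-- Any subset of `A × B × C` is mapped injectively. -/
theorem tripleMap_injOn_filter (P : G × G × G → Prop) [DecidablePred P] :
    Set.InjOn (tripleMap f) ↑((A ×ˢ B ×ˢ C).filter P) :=
  (tripleMap_injOn f hA hB hC).mono (coe_subset.2 (filter_subset _ _))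

include hr in
/-- The solutions of the image sets are the images of the solutions. -/
theorem sol_image :
    sol (A.image f) (B.image f) (C.image f) = (sol A B C).image (tripleMap f) := by
  ext ⟨α, β, γ⟩
  simp only [sol, mem_filter, mem_product, mem_image, tripleMap, Prod.mk.injEq, Prod.exists]
  constructor
  · rintro ⟨⟨⟨a, ha, rfl⟩, ⟨b, hb, rfl⟩, ⟨c, hc, rfl⟩⟩, h⟩
    refine ⟨a, b, c, ⟨⟨ha, hb, hc⟩, hr a ha b hb c hc ?_⟩, rfl, rfl, rfl⟩
    rw [map_add, map_add]; exact h
  · rintro ⟨a, b, c, ⟨⟨ha, hb, hc⟩, h⟩, rfl, rfl, rfl⟩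
    refine ⟨⟨⟨a, ha, rfl⟩, ⟨b, hb, rfl⟩, ⟨c, hc, rfl⟩⟩, ?_⟩
    rw [← map_add, ← map_add, h, map_zero]

include hA hB hC hr in
/-- The number of solutions is preserved. -/
theorem card_sol_image : #(sol (A.image f) (B.image f) (C.image f)) = #(sol A B C) := by
  rw [sol_image f hr]
  exact card_image_of_injOn (tripleMap_injOn_filter f hA hB hC _)

include hr in
/-- System (1) of the image sets at `(f a', f b')` is the image of system (1) at `(a', b')`. -/
theorem sysC_image {a' b' : G} (ha' : a' ∈ A) (hb' : b' ∈ B) :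
    sysC (A.image f) (B.image f) (C.image f) (f a') (f b') =
      (sysC A B C a' b').image (tripleMap f) := by
  ext ⟨α, β, γ⟩
  simp only [sysC, mem_filter, mem_product, mem_image, tripleMap, Prod.mk.injEq, Prod.exists]
  constructor
  · rintro ⟨⟨⟨a, ha, rfl⟩, ⟨b, hb, rfl⟩, ⟨c, hc, rfl⟩⟩, h1, h2⟩
    refine ⟨a, b, c, ⟨⟨ha, hb, hc⟩, hr a' ha' b hb c hc ?_, hr a ha b' hb' c hc ?_⟩, rfl, rfl, rfl⟩
    · rw [map_add, map_add]; exact h1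
    · rw [map_add, map_add]; exact h2
  · rintro ⟨a, b, c, ⟨⟨ha, hb, hc⟩, h1, h2⟩, rfl, rfl, rfl⟩
    refine ⟨⟨⟨a, ha, rfl⟩, ⟨b, hb, rfl⟩, ⟨c, hc, rfl⟩⟩, ?_, ?_⟩
    · rw [← map_add, ← map_add, h1, map_zero]
    · rw [← map_add, ← map_add, h2, map_zero]

include hr in
/-- Same for system (2). -/
theorem sysB_image {a' c' : G} (ha' : a' ∈ A) (hc' : c' ∈ C) :
    sysB (A.image f) (B.image f) (C.image f) (f a') (f c') =
      (sysB A B C a' c').image (tripleMap f) := by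
  ext ⟨α, β, γ⟩
  simp only [sysB, mem_filter, mem_product, mem_image, tripleMap, Prod.mk.injEq, Prod.exists]
  constructor
  · rintro ⟨⟨⟨a, ha, rfl⟩, ⟨b, hb, rfl⟩, ⟨c, hc, rfl⟩⟩, h1, h2⟩
    refine ⟨a, b, c, ⟨⟨ha, hb, hc⟩, hr a' ha' b hb c hc ?_, hr a ha b hb c' hc' ?_⟩, rfl, rfl, rfl⟩
    · rw [map_add, map_add]; exact h1
    · rw [map_add, map_add]; exact h2
  · rintro ⟨a, b, c, ⟨⟨ha, hb, hc⟩, h1, h2⟩, rfl, rfl, rfl⟩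
    refine ⟨⟨⟨a, ha, rfl⟩, ⟨b, hb, rfl⟩, ⟨c, hc, rfl⟩⟩, ?_, ?_⟩
    · rw [← map_add, ← map_add, h1, map_zero]
    · rw [← map_add, ← map_add, h2, map_zero]

include hr in
/-- Same for system (3). -/
theorem sysA_image {b' c' : G} (hb' : b' ∈ B) (hc' : c' ∈ C) :
    sysA (A.image f) (B.image f) (C.image f) (f b') (f c') =
      (sysA A B C b' c').image (tripleMap f) := by
  ext ⟨α, β, γ⟩
  simp only [sysA, mem_filter, mem_product, mem_image, tripleMap, Prod.mk.injEq, Prod.exists]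
  constructor
  · rintro ⟨⟨⟨a, ha, rfl⟩, ⟨b, hb, rfl⟩, ⟨c, hc, rfl⟩⟩, h1, h2⟩
    refine ⟨a, b, c, ⟨⟨ha, hb, hc⟩, hr a ha b' hb' c hc ?_, hr a ha b hb c' hc' ?_⟩, rfl, rfl, rfl⟩
    · rw [map_add, map_add]; exact h1
    · rw [map_add, map_add]; exact h2
  · rintro ⟨a, b, c, ⟨⟨ha, hb, hc⟩, h1, h2⟩, rfl, rfl, rfl⟩
    refine ⟨⟨⟨a, ha, rfl⟩, ⟨b, hb, rfl⟩, ⟨c, hc, rfl⟩⟩, ?_, ?_⟩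
    · rw [← map_add, ← map_add, h1, map_zero]
    · rw [← map_add, ← map_add, h2, map_zero]

include hA hB hC hr in
/-- `sumC` is preserved. -/
theorem sumC_image : sumC (A.image f) (B.image f) (C.image f) = sumC A B C := by
  unfold sumC
  rw [sum_image fun x hx y hy h => hA hx hy h]
  refine sum_congr rfl fun a' ha' => ?_
  rw [sum_image fun x hx y hy h => hB hx hy h]
  refine sum_congr rfl fun b' hb' => ?_
  rw [sysC_image f hr ha' hb']
  exact card_image_of_injOn (tripleMap_injOn_filter f hA hB hC _)

include hA hB hC hr in
/-- `sumB` is preserved. -/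
theorem sumB_image : sumB (A.image f) (B.image f) (C.image f) = sumB A B C := by
  unfold sumB
  rw [sum_image fun x hx y hy h => hA hx hy h]
  refine sum_congr rfl fun a' ha' => ?_
  rw [sum_image fun x hx y hy h => hC hx hy h]
  refine sum_congr rfl fun c' hc' => ?_
  rw [sysB_image f hr ha' hc']
  exact card_image_of_injOn (tripleMap_injOn_filter f hA hB hC _)

include hA hB hC hr in
/-- `sumA` is preserved. -/
theorem sumA_image : sumA (A.image f) (B.image f) (C.image f) = sumA A B C := by
  unfold sumA
  rw [sum_image fun x hx y hy h => hB hx hy h]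
  refine sum_congr rfl fun b' hb' => ?_
  rw [sum_image fun x hx y hy h => hC hx hy h]
  refine sum_congr rfl fun c' hc' => ?_
  rw [sysA_image f hr hb' hc']
  exact card_image_of_injOn (tripleMap_injOn_filter f hA hB hC _)

include hA hB hC hr in
/-- The averaged trapezoid conditions are preserved. -/
theorem avgTrapezoidFree_image (h : AvgTrapezoidFree A B C) :
    AvgTrapezoidFree (A.image f) (B.image f) (C.image f) := by
  obtain ⟨h1, h2, h3⟩ := h
  refine ⟨?_, ?_, ?_⟩
  · rw [sumC_image f hA hB hC hr, card_image_of_injOn hA, card_image_of_injOn hB]; exact h1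
  · rw [sumB_image f hA hB hC hr, card_image_of_injOn hA, card_image_of_injOn hC]; exact h2
  · rw [sumA_image f hA hB hC hr, card_image_of_injOn hB, card_image_of_injOn hC]; exact h3

end Transfer

end Summit.MatrixMultiplication.MatrixMultiplication.Theorems.SoloValAvg
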